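import Mathlib
import HarnessLib
import Summits.HubbardSuperconductivity.HubbardSuperconductivity.Theorems.KLProgrammeKLRegimeWickScaleFlowGenericData
import Summits.HubbardSuperconductivity.HubbardSuperconductivity.Theorems.KLProgrammeKLRegimeWickScaleFlowSlice

/-!
# Route `KLProgramme` — crux K3, ENGINE child gen 7-flow (stmt-HubbardSuperconductivity-20368 `KLRegimeEngineV17F`), stub `stub_engine_step_values`,
# conjunct (E2-F) at `1 ≤ n`: two calculus tools for the continuous bridge — the affine reparametrisation of a covariance family and the cumulative
# dressing built from a rate — `klws_covCurve_affine_derivs`, `klws_cumulative_of_rate`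

Cell gate-hubbard-kl, seat hubbard-kl-k3c1-p1 (g7), technique «composed-map remainder propagation».  Glue between the landed generic doors and their
model suppliers:

* **`klws_covCurve_affine_derivs`** — a covariance family `Λ ↦ C_Λ` with entrywise first and second `Λ`-derivatives on the slice `[Λ₁, Λ₀]` (p1 g10's dressed
  family: `klws_hasDerivAt_dressedSliceCov_of_mem` / `klws_hasDerivAt_deriv_dressedSliceCov_of_mem`, p525206) gives, along the affine path
  `Λ(r) = Λ₀ + r(Λ₁ − Λ₀)`, the curve `r ↦ C_{Λ(r)}` with entrywise derivatives `(Λ₁−Λ₀)·C′_{Λ(r)}` and `(Λ₁−Λ₀)²·C″_{Λ(r)}` on `[0,1]` — the `hC`, `hC'` inputs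
  of `klws_pairKernel_flowData_of_covCurve` (p524128);
* **`klws_cumulative_of_rate`** — from a rate `ȧ : ℝ → ι → ℂ` continuous on `[0,1]`, the cumulative dressing `a_t(x) := ∫₀ᵗ ȧ` (built with the clamped
  extension, as in `kltc_riccati_duhamel_conjugated` p522267): `a 0 = 0`, `HasDerivAt (a · x) (ȧ t x) t` on `[0,1]`, and `‖a t x‖ ≤ ∫₀¹‖ȧ_s(x)‖ds` — the
  `α, γ` inputs (`hα`, `hα0`, `hαA`) of `kltc_riccati_duhamel_conjugated` / `kltc_wickStep_of_flow_conjugated` / `pairLadderStepAtV10_of_scaleFlow_dressed`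
  from the one-line leg-insertion RATE alone.

Exact calculus; nothing about the model is asserted.  0 kit.
-/

noncomputable section

namespace Summit.HubbardSuperconductivity.HubbardSuperconductivity.Theorems.KLRegimeWick

set_option linter.dupNamespace false -- summit = problem name (single-conjunct summit), D-0017

open Set Finset Matrix
open scoped Topology

section Generic

variable {Γ : Type*} {ι : Type*}

/-- **Affine reparametrisation of a twice-differentiable covariance family.**  If `Λ ↦ C_Λ X Y` has derivative `C′_Λ X Y` and `Λ ↦ C′_Λ X Y` has derivative
`C″_Λ X Y` at every `Λ ∈ [Λ₁, Λ₀]` (`Λ₁ ≤ Λ₀`), then along `Λ(r) = Λ₀ + r(Λ₁ − Λ₀)` the curve `r ↦ C_{Λ(r)}` has entrywise derivative `(Λ₁−Λ₀)•C′_{Λ(r)}` and that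
has derivative `(Λ₁−Λ₀)²•C″_{Λ(r)}`, for every `r ∈ [0,1]`. -/
theorem klws_covCurve_affine_derivs {Λ₀ Λ₁ : ℝ} (h10 : Λ₁ ≤ Λ₀) (C C' C'' : ℝ → Matrix Γ Γ ℂ)
    (hC : ∀ Λ ∈ Icc Λ₁ Λ₀, ∀ X Y, HasDerivAt (fun Λ' => C Λ' X Y) (C' Λ X Y) Λ)
    (hC' : ∀ Λ ∈ Icc Λ₁ Λ₀, ∀ X Y, HasDerivAt (fun Λ' => C' Λ' X Y) (C'' Λ X Y) Λ) :
    (∀ r ∈ Icc (0 : ℝ) 1, ∀ X Y, HasDerivAt (fun s => C (Λ₀ + s * (Λ₁ - Λ₀)) X Y)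
        (((Λ₁ - Λ₀ : ℝ) : ℂ) * C' (Λ₀ + r * (Λ₁ - Λ₀)) X Y) r) ∧
    (∀ r ∈ Icc (0 : ℝ) 1, ∀ X Y, HasDerivAt (fun s => ((Λ₁ - Λ₀ : ℝ) : ℂ) * C' (Λ₀ + s * (Λ₁ - Λ₀)) X Y)
        (((Λ₁ - Λ₀ : ℝ) : ℂ) ^ 2 * C'' (Λ₀ + r * (Λ₁ - Λ₀)) X Y) r) := by
  have hmem : ∀ r ∈ Icc (0 : ℝ) 1, Λ₀ + r * (Λ₁ - Λ₀) ∈ Icc Λ₁ Λ₀ := fun r hr => klws_affine_mem_Icc h10 hr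
  have haff : ∀ r : ℝ, HasDerivAt (fun s : ℝ => Λ₀ + s * (Λ₁ - Λ₀)) (Λ₁ - Λ₀) r := fun r => klws_hasDerivAt_affine Λ₀ Λ₁ r
  refine ⟨fun r hr X Y => ?_, fun r hr X Y => ?_⟩
  · have h := (hC _ (hmem r hr) X Y).scomp r (haff r)
    simpa only [Function.comp_def, Complex.real_smul] using h
  · have h := ((hC' _ (hmem r hr) X Y).scomp r (haff r)).const_mul (((Λ₁ - Λ₀ : ℝ) : ℂ))
    have h2 : ((Λ₁ - Λ₀ : ℝ) : ℂ) * ((Λ₁ - Λ₀) • C'' (Λ₀ + r * (Λ₁ - Λ₀)) X Y) =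
        ((Λ₁ - Λ₀ : ℝ) : ℂ) ^ 2 * C'' (Λ₀ + r * (Λ₁ - Λ₀)) X Y := by
      rw [Complex.real_smul]; ring
    rw [← h2]
    simpa only [Function.comp_def] using h

/-- **The cumulative dressing built from a continuous rate.**  For `ȧ : ℝ → ι → ℂ` with `ȧ · x` continuous on `[0,1]` there is `a : ℝ → ι → ℂ` with `a 0 = 0`,
`HasDerivAt (a · x) (ȧ t x) t` for every `t ∈ [0,1]` (two-sided, via the clamped continuous extension), and `‖a t x‖ ≤ ∫₀¹‖ȧ_s(x)‖ds` on `[0,1]`. -/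
theorem klws_cumulative_of_rate (ad : ℝ → ι → ℂ) (hadc : ∀ x, ContinuousOn (fun t => ad t x) (Icc 0 1)) :
    ∃ a : ℝ → ι → ℂ, a 0 = 0 ∧ (∀ t ∈ Icc (0 : ℝ) 1, ∀ x, HasDerivAt (fun s => a s x) (ad t x) t) ∧
      ∀ t ∈ Icc (0 : ℝ) 1, ∀ x, ‖a t x‖ ≤ ∫ s in (0 : ℝ)..1, ‖ad s x‖ := by
  -- clamp to `[0,1]`
  set π : ℝ → ℝ := fun s => max 0 (min 1 s) with hπ_def
  have hπc : Continuous π := continuous_const.max (continuous_const.min continuous_id)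
  have hπmem : ∀ s, π s ∈ Icc (0 : ℝ) 1 := fun s => ⟨le_max_left _ _, max_le zero_le_one (min_le_left _ _)⟩
  have hπid : ∀ s ∈ Icc (0 : ℝ) 1, π s = s := fun s hs => by
    rw [hπ_def]; dsimp only; rw [min_eq_right hs.2, max_eq_right hs.1]
  set ae : ℝ → ι → ℂ := fun s x => ad (π s) x with hae_def
  have haec : ∀ x, Continuous fun s => ae s x := fun x => (hadc x).comp_continuous hπc hπmem
  have haeon : ∀ s ∈ Icc (0 : ℝ) 1, ∀ x, ae s x = ad s x := fun s hs x => by simp only [hae_def, hπid s hs]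
  refine ⟨fun t x => ∫ s in (0 : ℝ)..t, ae s x, ?_, fun t ht x => ?_, fun t ht x => ?_⟩
  · funext x; simp
  · have h := intervalIntegral.integral_hasDerivAt_right ((haec x).intervalIntegrable 0 t)
      ((haec x).stronglyMeasurableAtFilter _ _) (haec x).continuousAt
    rw [haeon t ht x] at h
    exact h
  · have hint : ∀ u v : ℝ, IntervalIntegrable (fun s => ae s x) MeasureTheory.volume u v := fun u v => (haec x).intervalIntegrable _ _
    calc ‖∫ s in (0 : ℝ)..t, ae s x‖ ≤ ∫ s in (0 : ℝ)..t, ‖ae s x‖ := intervalIntegral.norm_integral_le_integral_norm ht.1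
      _ ≤ ∫ s in (0 : ℝ)..1, ‖ae s x‖ :=
          intervalIntegral.integral_mono_interval le_rfl ht.1 ht.2 (Filter.Eventually.of_forall fun s => norm_nonneg _)
            ((hint 0 1).norm)
      _ = ∫ s in (0 : ℝ)..1, ‖ad s x‖ := by
          refine intervalIntegral.integral_congr fun s hs => ?_
          rw [Set.uIcc_of_le zero_le_one] at hs
          simp only [haeon s hs x]

end Generic

end Summit.HubbardSuperconductivity.HubbardSuperconductivity.Theorems.KLRegimeWick

end
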